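import Summits.CriticalPhenomena.PercolationContinuityZ3.Theorems.PercNearOneGluingNoHeavyLowerTailApexForestConjectureOne
import Summits.CriticalPhenomena.PercolationContinuityZ3.Theorems.PercNearOneGluingNoHeavyLowerTailApexForestPreFKGLocal
import Summits.CriticalPhenomena.PercolationContinuityZ3.Theorems.PercNearOneGluingNoHeavyLowerTailApexForestDesignatedLocal
import Summits.CriticalPhenomena.PercolationContinuityZ3.Theorems.PercNearOneGluingNoHeavyLowerTailCornerPrinciple
import Mathlib.Combinatorics.SimpleGraph.Acyclic
import HarnessLib

/-!
# DESIGNATED Kozma–Nitzan Conjecture 1 on APEX-FOREST graphs: the worst relay of `G − E(o)` certifies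
# (`NoHeavyLowerTail` cell, stmt-CriticalPhenomena-4575; new-inequality factory seat `prim-ineq-gen-7`, gen 4)

Support file (`--supports stmt-CriticalPhenomena-4575`); no definitions, no named facts, no sorries.  Paper: run/shared/lean/prim/prim-ineq-gen-7/FINDING-RING-g4.md §3–§4.
`ApexForest.eventGluing` (p197420) says SOME relay certifies `μ(o ↔ A, o ↮ c) ≤ μ(a ↮ c)·μ(o ↔ A ∪ {c})`; here the relay is DESIGNATED independently of the weights at `o`:
`wr` := any maximiser of `μ_{w⁰}(a ↮ c)` over `a ∈ A`, where `w⁰` is `w` with every pair containing `o` given weight `0` (the worst relay of `G − E(o)`, Kozma–Nitzan's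
designation `argmin P_{G − edges(o)}(a ↔ b)` of their Questions 8–9).

* `ApexForest.designated_corner` — the claim when every forest pair at `o` has weight `0` or `1` (then `o` is glued to some of its blocks: the DESIGNATED STAR LEMMA —
  `designated_step` across the bridge leading to `wr`, with `wr` dominating both sides through weight-monotonicity and weak localisation; or, if `wr` is cut from `o`,
  `eventGluing` plus `μ_v(wr ↮ c) = μ_{v⁰}(wr ↮ c) ≥ μ_{v⁰}(a ↮ c) ≥ μ_v(a ↮ c)`).
* `ApexForest.designated` — **for every apex-forest instance, every `o ∉ A`, `c ∉ A` and every such `wr`: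
  `μ(o ↔ A, o ↮ c) ≤ μ(wr ↮ c) · μ(o ↔ A ∪ {c})`** — by the corner principle `Corner.nonneg_of_corners` (p202064) over the forest pairs at `o`.
[cite: KozmaNitzan2024, Conjecture 1 (p. 3), Questions 8–9] [cite: Grimmett1999, §1.3, §2.2, Thm. (2.1)]
-/

namespace Summit.CriticalPhenomena.PercolationContinuityZ3.Theorems

namespace ApexForest

open MeasureTheory Set Literature.Probability.LatticeModels Literature.Probability.Percolation ApexForestBridge ApexForestWalks
open scoped Classical

variable {n : ℕ}

/-- No vertex reachable in `fromEdgeSet D` from a vertex `x ≠ c` is `c`, when `D` avoids `c`. [folklore] -/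
theorem ne_hub_of_reachable {D : Set (Sym2 (Fin n))} {c : Fin n} (hDc : ∀ p ∈ D, c ∉ p) {x y : Fin n}
    (hxy : (SimpleGraph.fromEdgeSet D).Reachable x y) (hxc : x ≠ c) : y ≠ c := by
  intro hyc
  subst hyc
  rw [SimpleGraph.reachable_iff_reflTransGen] at hxy
  rcases Relation.ReflTransGen.cases_tail hxy with h | ⟨z, _, hzc⟩
  · exact hxc h.symm
  · exact hDc _ ((SimpleGraph.fromEdgeSet_adj _).1 hzc).1 (Sym2.mem_mk_right z y)

/-- A component of `fromEdgeSet D` is closed: a pair of `D` with one end in the component has the other end in it. [folklore] -/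
theorem mem_component_of_mem {D : Set (Sym2 (Fin n))} {x y z : Fin n}
    (hy : (SimpleGraph.fromEdgeSet D).Reachable x y) (hyz : s(y, z) ∈ D) : (SimpleGraph.fromEdgeSet D).Reachable x z := by
  by_cases h : y = z
  · exact h ▸ hy
  · exact hy.trans (SimpleGraph.Adj.reachable ((SimpleGraph.fromEdgeSet_adj _).2 ⟨hyz, h⟩))

/-- **The designated claim at a corner.**  `v` an apex-forest weight (support in `D` ∪ hub pairs) with every pair of `D` at `o` of weight `0` or `1`; `o ∉ A`, `c ∉ A`;
`wr ∈ A` maximises `μ_{v⁰}(· ↮ c)` where `v⁰` zeroes the pairs containing `o`.  Then `μ_v(o ↔ A, o ↮ c) ≤ μ_v(wr ↮ c)·μ_v(o ↔ A ∪ {c})`.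
[cite: KozmaNitzan2024, Conjecture 1 (p. 3)] -/
theorem designated_corner (v : Sym2 (Fin n) → unitInterval) (c : Fin n) (D : Finset (Sym2 (Fin n)))
    (hDc : ∀ p ∈ D, c ∉ p) (hacyc : (SimpleGraph.fromEdgeSet (↑D : Set (Sym2 (Fin n)))).IsAcyclic)
    (hv : ∀ p : Sym2 (Fin n), p ∉ D → c ∉ p → (v p : ℝ) = 0) (A : Finset (Fin n)) (o : Fin n) (hoc : o ≠ c) (hoA : o ∉ A) (hcA : c ∉ A)
    (h01 : ∀ p ∈ D, o ∈ p → v p = 0 ∨ v p = 1) (wr : Fin n) (hwr : wr ∈ A)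
    (hmax : ∀ a ∈ A, (prodBernoulli (fun p => if o ∈ p then 0 else v p)).real (openConn a c : Set (BondConfig (Fin n)))ᶜ ≤
      (prodBernoulli (fun p => if o ∈ p then 0 else v p)).real (openConn wr c : Set (BondConfig (Fin n)))ᶜ) :
    (prodBernoulli v).real ((⋃ a ∈ A, (openConn o a : Set (BondConfig (Fin n)))) ∩ (openConn o c : Set (BondConfig (Fin n)))ᶜ) ≤
      (prodBernoulli v).real (openConn wr c : Set (BondConfig (Fin n)))ᶜ *
        (prodBernoulli v).real (⋃ a ∈ insert c A, (openConn o a : Set (BondConfig (Fin n)))) := by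
  set v0 : Sym2 (Fin n) → unitInterval := fun p => if o ∈ p then 0 else v p with hv0def
  have hv0le : v0 ≤ v := fun p => by
    simp only [hv0def]; split_ifs
    · exact (v p).2.1
    · exact le_rfl
  have hwrc : wr ≠ c := fun h => hcA (h ▸ hwr)
  have howr : o ≠ wr := fun h => hoA (h ▸ hwr)
  -- remove the forest pairs at `o` of weight 0
  set Dp : Finset (Sym2 (Fin n)) := D.filter fun p => ¬ (o ∈ p ∧ v p = 0) with hDp
  have hDpc : ∀ p ∈ Dp, c ∉ p := fun p hp => hDc p (Finset.mem_filter.1 hp).1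
  have hDpc' : ∀ p ∈ (↑Dp : Set (Sym2 (Fin n))), c ∉ p := fun p hp => hDpc p (Finset.mem_coe.1 hp)
  have hacycp : (SimpleGraph.fromEdgeSet (↑Dp : Set (Sym2 (Fin n)))).IsAcyclic :=
    hacyc.anti (SimpleGraph.fromEdgeSet_mono (by intro p hp; exact Finset.mem_coe.2 (Finset.mem_filter.1 (Finset.mem_coe.1 hp)).1))
  have hvp : ∀ p : Sym2 (Fin n), p ∉ Dp → c ∉ p → (v p : ℝ) = 0 := by
    intro p hp hcp
    by_cases hpD : p ∈ D
    · have h2 : o ∈ p ∧ v p = 0 := by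
        by_contra h'
        exact hp (Finset.mem_filter.2 ⟨hpD, h'⟩)
      rw [h2.2]; rfl
    · exact hv p hpD hcp
  have hvp' : ∀ p : Sym2 (Fin n), p ∉ (↑Dp : Set (Sym2 (Fin n))) → c ∉ p → (v p : ℝ) = 0 :=
    fun p hp hcp => hvp p (fun h => hp (Finset.mem_coe.2 h)) hcp
  have hone : ∀ p ∈ Dp, o ∈ p → v p = 1 := by
    intro p hp hop
    obtain ⟨hpD, hn⟩ := Finset.mem_filter.1 hp
    rcases h01 p hpD hop with h0 | h1
    · exact absurd ⟨hop, h0⟩ hn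
    · exact h1
  have hle1 : ∀ E : Set (BondConfig (Fin n)), (prodBernoulli v).real E ≤ 1 := fun E =>
    (measureReal_mono (Set.subset_univ E)).trans_eq probReal_univ
  -- the sharp claim for `v` with the instance `Dp`
  have hEG := eventGluing v c Dp hDpc hacycp hvp A ⟨wr, hwr⟩ o hoc
  by_cases hR : (SimpleGraph.fromEdgeSet (↑Dp : Set (Sym2 (Fin n)))).Reachable o wr
  swap
  · ----------------------------------------------------------------
    -- CASE B: `wr` is cut from `o`: μ_v(wr ↮ c) = μ_{v⁰}(wr ↮ c) ≥ μ_{v⁰}(a ↮ c) ≥ μ_v(a ↮ c)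
    ----------------------------------------------------------------
    set K : Set (Fin n) := {x | (SimpleGraph.fromEdgeSet (↑Dp : Set (Sym2 (Fin n)))).Reachable wr x} with hK
    have hwrK : wr ∈ K := SimpleGraph.Reachable.refl _
    have hcK : c ∉ K := fun h => ne_hub_of_reachable hDpc' h hwrc rfl
    have hclosed : ∀ u : Sym2 (Fin n) → unitInterval, u ≤ v → ∀ y ∈ K, ∀ z, z ∉ K → z ≠ c → (u s(y, z) : ℝ) = 0 := by
      intro u hu y hy z hz hzc
      have hnot : s(y, z) ∉ Dp := fun h => hz (mem_component_of_mem hy (Finset.mem_coe.2 h))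
      have hyc : y ≠ c := fun h => hcK (h ▸ hy)
      have h0 := hvp _ hnot (by rw [Sym2.mem_iff]; rintro (h | h); exacts [hyc h.symm, hzc h.symm])
      have h1 : (u s(y, z) : ℝ) ≤ v s(y, z) := hu _
      exact le_antisymm (h1.trans_eq h0) (u s(y, z)).2.1
    have hloc_v := real_not_openConn_hub_closed v K c wr hwrK hcK (hclosed v le_rfl)
    have hloc_v0 := real_not_openConn_hub_closed v0 K c wr hwrK hcK (hclosed v0 hv0le)
    have hsame : (prodBernoulli v0).real {ω : BondConfig (Fin n) | ∀ u, ω ∈ openConnIn K wr u → s(u, c) ∉ ω} =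
        (prodBernoulli v).real {ω : BondConfig (Fin n) | ∀ u, ω ∈ openConnIn K wr u → s(u, c) ∉ ω} := by
      refine prodBernoulli_real_eq_of_determinedBy v0 v (F := {p | p ∈ wireSet K ∨ ∃ u ∈ K, p = s(u, c)}) (fun p hp => ?_)
        (ApexForestMeasure.determinedBy_hubClosed K wr c (fun p hp => Or.inl hp) (fun u hu => Or.inr ⟨u, hu, rfl⟩)) MeasurableSet.of_discrete
      have hoK : o ∉ K := fun h => hR h.symm
      have hop : o ∉ p := by
        rcases hp with hp | ⟨u, hu, rfl⟩
        · intro hop; exact hoK (hp.1 o hop)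
        · rw [Sym2.mem_iff]; rintro (h | h)
          · exact hoK (h ▸ hu)
          · exact hoc h
      simp only [hv0def, hop, if_false]
    have hdom : ∀ a ∈ A, (prodBernoulli v).real (openConn a c : Set (BondConfig (Fin n)))ᶜ ≤ (prodBernoulli v).real (openConn wr c : Set (BondConfig (Fin n)))ᶜ := by
      intro a ha
      calc (prodBernoulli v).real (openConn a c : Set (BondConfig (Fin n)))ᶜ
          ≤ (prodBernoulli v0).real (openConn a c : Set (BondConfig (Fin n)))ᶜ := real_compl_openConn_mono hv0le a c
        _ ≤ (prodBernoulli v0).real (openConn wr c : Set (BondConfig (Fin n)))ᶜ := hmax a ha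
        _ = (prodBernoulli v).real (openConn wr c : Set (BondConfig (Fin n)))ᶜ := by rw [hloc_v0, hsame, ← hloc_v]
    have hsup : A.sup' ⟨wr, hwr⟩ (fun a => (prodBernoulli v).real (openConn a c : Set (BondConfig (Fin n)))ᶜ) ≤
        (prodBernoulli v).real (openConn wr c : Set (BondConfig (Fin n)))ᶜ := Finset.sup'_le _ _ hdom
    exact hEG.trans (mul_le_mul_of_nonneg_right hsup measureReal_nonneg)
  ----------------------------------------------------------------
  -- CASE A: `wr` lies in the component of `o`; first edge `e = s(o, u₁)` of a path, `v e = 1`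
  ----------------------------------------------------------------
  obtain ⟨pw⟩ := hR
  have hpath := pw.bypass_isPath
  obtain ⟨u₁, hadj, q, hq⟩ : ∃ u₁, (SimpleGraph.fromEdgeSet (↑Dp : Set (Sym2 (Fin n)))).Adj o u₁ ∧
      ∃ q : (SimpleGraph.fromEdgeSet (↑Dp : Set (Sym2 (Fin n)))).Walk u₁ wr, o ∉ q.support := by
    cases hpw : pw.bypass with
    | nil => exact absurd rfl howr
    | cons hadj q =>
      rename_i u₁
      refine ⟨u₁, hadj, q, ?_⟩
      have hnd := hpath.support_nodup
      rw [hpw, SimpleGraph.Walk.support_cons, List.nodup_cons] at hnd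
      exact hnd.1
  have heDp : s(o, u₁) ∈ (↑Dp : Set (Sym2 (Fin n))) := ((SimpleGraph.fromEdgeSet_adj _).1 hadj).1
  have hov : o ≠ u₁ := ((SimpleGraph.fromEdgeSet_adj _).1 hadj).2
  have hq1 : (v s(o, u₁) : ℝ) = 1 := by rw [hone _ (Finset.mem_coe.1 heDp) (Sym2.mem_mk_left o u₁)]; rfl
  have hbridge : ¬ (SimpleGraph.fromEdgeSet ((↑Dp : Set (Sym2 (Fin n))) \ {s(o, u₁)})).Reachable o u₁ := by
    have hb := SimpleGraph.isAcyclic_iff_forall_adj_isBridge.1 hacycp hadj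
    rw [SimpleGraph.isBridge_iff, SimpleGraph.deleteEdges_fromEdgeSet] at hb
    exact hb
  -- `wr` is on the `u₁`-side
  have hwrS : (SimpleGraph.fromEdgeSet ((↑Dp : Set (Sym2 (Fin n))) \ {s(o, u₁)})).Reachable u₁ wr := by
    have hedges : ∀ e ∈ q.edges, e ∉ ({s(o, u₁)} : Set (Sym2 (Fin n))) := by
      intro e he hes
      rw [Set.mem_singleton_iff] at hes
      subst hes
      exact hq (q.fst_mem_support_of_mem_edges he)
    have := (q.toDeleteEdges {s(o, u₁)} hedges).reachable
    rwa [SimpleGraph.deleteEdges_fromEdgeSet] at this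
  -- (M1)–(M3) and side facts
  have hM1 := ApexForestMeasure.real_not_openConn_hub v hDpc' hov heDp hbridge hvp'
  have hM2 := ApexForestMeasure.real_not_openConn_hub_relays v A hDpc' hov heDp hbridge hvp'
  have hM3 := ApexForestMeasure.real_not_openConn_hub_of_side v hDpc' hov heDp hbridge hwrS hvp'
  obtain ⟨hdisjS, hcSo, hcS₁, hoSo, hvS₁⟩ := ApexForestMeasure.sides_facts hDpc' heDp hbridge
  rw [hq1] at hM1 hM2 hM3
  set So : Set (Fin n) := {x | (SimpleGraph.fromEdgeSet ((↑Dp : Set (Sym2 (Fin n))) \ {s(o, u₁)})).Reachable o x} with hSo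
  set S₁ : Set (Fin n) := {x | (SimpleGraph.fromEdgeSet ((↑Dp : Set (Sym2 (Fin n))) \ {s(o, u₁)})).Reachable u₁ x} with hS₁
  set a : ℝ := (prodBernoulli v).real {ω : BondConfig (Fin n) | ∀ u, ω ∈ openConnIn So o u → s(u, c) ∉ ω} with ha
  set b : ℝ := (prodBernoulli v).real {ω : BondConfig (Fin n) | ∀ u, ω ∈ openConnIn So o u → s(u, c) ∉ ω ∧ u ∉ A} with hb
  set g : ℝ := (prodBernoulli v).real {ω : BondConfig (Fin n) | ∀ u, ω ∈ openConnIn S₁ u₁ u → s(u, c) ∉ ω} with hg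
  set h : ℝ := (prodBernoulli v).real {ω : BondConfig (Fin n) | ∀ u, ω ∈ openConnIn S₁ u₁ u → s(u, c) ∉ ω ∧ u ∉ A} with hh
  set d : ℝ := (prodBernoulli v).real {ω : BondConfig (Fin n) | ∀ u, ω ∈ openConnIn S₁ wr u → s(u, c) ∉ ω} with hd
  set ew : ℝ := (prodBernoulli v).real ({ω : BondConfig (Fin n) | ∀ u, ω ∈ openConnIn S₁ wr u → s(u, c) ∉ ω} ∩ openConnIn S₁ wr u₁) with hew
  have hoS₁ : o ∉ S₁ := fun h' => Set.disjoint_left.1 hdisjS hoSo h'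
  have hHsubo : {ω : BondConfig (Fin n) | ∀ u, ω ∈ openConnIn So o u → s(u, c) ∉ ω ∧ u ∉ A} ⊆
      {ω : BondConfig (Fin n) | ∀ u, ω ∈ openConnIn So o u → s(u, c) ∉ ω} := fun ω hω u hu => (hω u hu).1
  have hHsub₁ : {ω : BondConfig (Fin n) | ∀ u, ω ∈ openConnIn S₁ u₁ u → s(u, c) ∉ ω ∧ u ∉ A} ⊆
      {ω : BondConfig (Fin n) | ∀ u, ω ∈ openConnIn S₁ u₁ u → s(u, c) ∉ ω} := fun ω hω u hu => (hω u hu).1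
  have hb0 : 0 ≤ b := measureReal_nonneg
  have hba : b ≤ a := measureReal_mono hHsubo
  have ha1 : a ≤ 1 := hle1 _
  have hh0 : 0 ≤ h := measureReal_nonneg
  have hhg : h ≤ g := measureReal_mono hHsub₁
  have hg1 : g ≤ 1 := hle1 _
  have hew0 : 0 ≤ ew := measureReal_nonneg
  have hewX : ew ≤ g - h := by
    calc ew ≤ (prodBernoulli v).real ({ω : BondConfig (Fin n) | ∀ u, ω ∈ openConnIn S₁ u₁ u → s(u, c) ∉ ω} \
            {ω : BondConfig (Fin n) | ∀ u, ω ∈ openConnIn S₁ u₁ u → s(u, c) ∉ ω ∧ u ∉ A}) :=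
          measureReal_mono (hubClosed_conn_subset (S := S₁) (c := c) (v := u₁) hwr)
      _ = g - h := by rw [measureReal_sdiff hHsub₁ MeasurableSet.of_discrete]
  -- closedness of the two sides under any `u ≤ v`, and agreement of `v⁰` with `v` on the side pairs
  have hclosedS : ∀ (S : Set (Fin n)) (r : Fin n), S = {x | (SimpleGraph.fromEdgeSet ((↑Dp : Set (Sym2 (Fin n))) \ {s(o, u₁)})).Reachable r x} →
      c ∉ S → ∀ u : Sym2 (Fin n) → unitInterval, u ≤ v → (∀ p, o ∈ p → u p = 0) →
        ∀ y ∈ S, ∀ z, z ∉ S → z ≠ c → (u s(y, z) : ℝ) = 0 := by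
    intro S r hS hcS u hu hu0 y hy z hz hzc
    by_cases hop : o ∈ s(y, z)
    · rw [hu0 _ hop]; rfl
    · have hne : s(y, z) ≠ s(o, u₁) := fun h' => hop (h' ▸ Sym2.mem_mk_left o u₁)
      have hnot : s(y, z) ∉ Dp := by
        intro h'
        apply hz; rw [hS] at hy ⊢
        exact mem_component_of_mem hy ⟨Finset.mem_coe.2 h', hne⟩
      have hyc : y ≠ c := fun h' => hcS (h' ▸ hy)
      have h0 := hvp _ hnot (by rw [Sym2.mem_iff]; rintro (h' | h'); exacts [hyc h'.symm, hzc h'.symm])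
      exact le_antisymm ((show (u s(y, z) : ℝ) ≤ v s(y, z) from hu _).trans_eq h0) (u s(y, z)).2.1
  have hv0zero : ∀ p, o ∈ p → v0 p = 0 := fun p hp => by simp only [hv0def, hp, if_true]
  have hclS₁ := hclosedS S₁ u₁ rfl hcS₁ v0 hv0le hv0zero
  have hclSo := hclosedS So o rfl hcSo v0 hv0le hv0zero
  have hagree : ∀ (S : Set (Fin n)), o ∉ S → ∀ p ∈ {p : Sym2 (Fin n) | p ∈ wireSet S ∨ ∃ u ∈ S, p = s(u, c)}, v0 p = v p := by
    intro S hoS p hp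
    have hop : o ∉ p := by
      rcases hp with hp | ⟨u, hu, rfl⟩
      · intro hop; exact hoS (hp.1 o hop)
      · rw [Sym2.mem_iff]; rintro (h' | h')
        · exact hoS (h' ▸ hu)
        · exact hoc h'
    simp only [hv0def, hop, if_false]
  -- `d` is the designated value: d = μ_{v⁰}(wr ↮ c)
  have hd_eq : (prodBernoulli v0).real (openConn wr c : Set (BondConfig (Fin n)))ᶜ = d := by
    rw [real_not_openConn_hub_closed v0 S₁ c wr hwrS hcS₁ hclS₁]
    exact prodBernoulli_real_eq_of_determinedBy v0 v (hagree S₁ hoS₁)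
      (ApexForestMeasure.determinedBy_hubClosed S₁ wr c (fun p hp => Or.inl hp) (fun u hu => Or.inr ⟨u, hu, rfl⟩)) MeasurableSet.of_discrete
  -- every relay's side value is dominated by `d`
  have hdomS : ∀ (S : Set (Fin n)) (r : Fin n), S = {x | (SimpleGraph.fromEdgeSet ((↑Dp : Set (Sym2 (Fin n))) \ {s(o, u₁)})).Reachable r x} →
      c ∉ S → ∀ a' ∈ A, a' ∈ S →
        (prodBernoulli v).real {ω : BondConfig (Fin n) | ∀ u, ω ∈ openConnIn S a' u → s(u, c) ∉ ω} ≤ d := by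
    intro S r hS hcS a' ha'A ha'S
    have hcl := hclosedS S r hS hcS v0 hv0le hv0zero
    calc (prodBernoulli v).real {ω : BondConfig (Fin n) | ∀ u, ω ∈ openConnIn S a' u → s(u, c) ∉ ω}
        ≤ (prodBernoulli v0).real {ω : BondConfig (Fin n) | ∀ u, ω ∈ openConnIn S a' u → s(u, c) ∉ ω} :=
          real_mono_of_isLowerSet hv0le (isLowerSet_hubClosed S a' c)
      _ = (prodBernoulli v0).real (openConn a' c : Set (BondConfig (Fin n)))ᶜ := (real_not_openConn_hub_closed v0 S c a' ha'S hcS hcl).symm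
      _ ≤ (prodBernoulli v0).real (openConn wr c : Set (BondConfig (Fin n)))ᶜ := hmax a' ha'A
      _ = d := hd_eq
  -- child block certificate: g − h ≤ d(1 − h)
  have hchild : g - h ≤ d * (1 - h) := by
    set F₁ : Finset (Sym2 (Fin n)) := Finset.univ.filter fun p => p ∈ wireSet S₁ ∨ ∃ u ∈ S₁, p = s(u, c) with hF₁
    set w₁ : Sym2 (Fin n) → unitInterval := fun p => if p ∈ F₁ then v p else 0 with hw₁def
    have hon : ∀ p : Sym2 (Fin n), (p ∈ wireSet S₁ ∨ ∃ u ∈ S₁, p = s(u, c)) → w₁ p = v p := by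
      intro p hp; have hpF : p ∈ F₁ := Finset.mem_filter.2 ⟨Finset.mem_univ _, hp⟩; simp only [hw₁def, hpF, if_true]
    have hoff : ∀ p : Sym2 (Fin n), ¬ (p ∈ wireSet S₁ ∨ ∃ u ∈ S₁, p = s(u, c)) → (w₁ p : ℝ) = 0 := by
      intro p hp; have hpF : p ∉ F₁ := fun h' => hp (Finset.mem_filter.1 h').2; simp only [hw₁def, hpF, if_false]; rfl
    have hw₁ : ∀ p : Sym2 (Fin n), p ∉ Dp.erase s(o, u₁) → c ∉ p → (w₁ p : ℝ) = 0 := by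
      intro p hp hcp
      by_cases hpF : p ∈ wireSet S₁ ∨ ∃ u ∈ S₁, p = s(u, c)
      · rw [hon p hpF]
        rcases hpF with hW | ⟨u, _, rfl⟩
        · by_cases hpD : p ∈ Dp
          · exfalso; refine hp (Finset.mem_erase.2 ⟨?_, hpD⟩); rintro rfl
            exact Set.disjoint_left.1 hdisjS hoSo (mk_mem_wireSet_iff.1 hW).1
          · exact hvp p hpD hcp
        · exact absurd (Sym2.mem_mk_right u c) hcp
      · exact hoff p hpF
    have hu₁c : u₁ ≠ c := fun h' => hDpc _ (Finset.mem_coe.1 heDp) (h' ▸ Sym2.mem_mk_right o u₁)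
    have hDc₁ : ∀ p ∈ Dp.erase s(o, u₁), c ∉ p := fun p hp => hDpc p (Finset.mem_of_mem_erase hp)
    have hacyc₁ : (SimpleGraph.fromEdgeSet (↑(Dp.erase s(o, u₁)) : Set (Sym2 (Fin n)))).IsAcyclic := by
      rw [Finset.coe_erase]; exact hacycp.anti (SimpleGraph.fromEdgeSet_mono Set.sdiff_subset)
    have hA₁ : (A.filter fun x => x ∈ S₁).Nonempty := ⟨wr, Finset.mem_filter.2 ⟨hwr, hwrS⟩⟩
    obtain ⟨α₁, hα₁F, hle⟩ := eventGluing_aux (Dp.erase s(o, u₁)).card (Dp.erase s(o, u₁)) w₁ c u₁ (A.filter fun x => x ∈ S₁) rfl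
      hDc₁ hacyc₁ hw₁ hu₁c hA₁
    have hα₁A : α₁ ∈ A := (Finset.mem_filter.1 hα₁F).1
    have hα₁S : α₁ ∈ S₁ := (Finset.mem_filter.1 hα₁F).2
    have T1 : (prodBernoulli w₁).real (openConn u₁ c : Set (BondConfig (Fin n)))ᶜ = g :=
      real_local_not_openConn_hub v w₁ S₁ c u₁ hvS₁ hcS₁ hon hoff
    have T2 : (prodBernoulli w₁).real ((openConn u₁ c : Set (BondConfig (Fin n)))ᶜ ∩
        (⋃ a ∈ (A.filter fun x => x ∈ S₁), (openConn u₁ a : Set (BondConfig (Fin n))))ᶜ) = h := by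
      rw [real_local_not_openConn_hub_relays v w₁ S₁ c u₁ (A.filter fun x => x ∈ S₁) hvS₁ hcS₁ hon hoff, hubClosedRelayFree_filter_eq]
    have T3 : (prodBernoulli w₁).real (openConn α₁ c : Set (BondConfig (Fin n)))ᶜ =
        (prodBernoulli v).real {ω : BondConfig (Fin n) | ∀ u, ω ∈ openConnIn S₁ α₁ u → s(u, c) ∉ ω} :=
      real_local_not_openConn_hub v w₁ S₁ c α₁ hα₁S hcS₁ hon hoff
    rw [T1, T2, T3] at hle
    have hdα : (prodBernoulli v).real {ω : BondConfig (Fin n) | ∀ u, ω ∈ openConnIn S₁ α₁ u → s(u, c) ∉ ω} ≤ d := hdomS S₁ u₁ rfl hcS₁ α₁ hα₁A hα₁S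
    have h1h : 0 ≤ 1 - h := by linarith [hle1 {ω : BondConfig (Fin n) | ∀ u, ω ∈ openConnIn S₁ u₁ u → s(u, c) ∉ ω ∧ u ∉ A}]
    exact hle.trans (mul_le_mul_of_nonneg_right hdα h1h)
  -- root block certificate: a − b ≤ d(1 − b)
  have hroot : a - b ≤ d * (1 - b) := by
    by_cases hAo : (A.filter fun x => x ∈ So).Nonempty
    · set Fo : Finset (Sym2 (Fin n)) := Finset.univ.filter fun p => p ∈ wireSet So ∨ ∃ u ∈ So, p = s(u, c) with hFo
      set wo : Sym2 (Fin n) → unitInterval := fun p => if p ∈ Fo then v p else 0 with hwodef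
      have hon : ∀ p : Sym2 (Fin n), (p ∈ wireSet So ∨ ∃ u ∈ So, p = s(u, c)) → wo p = v p := by
        intro p hp; have hpF : p ∈ Fo := Finset.mem_filter.2 ⟨Finset.mem_univ _, hp⟩; simp only [hwodef, hpF, if_true]
      have hoff : ∀ p : Sym2 (Fin n), ¬ (p ∈ wireSet So ∨ ∃ u ∈ So, p = s(u, c)) → (wo p : ℝ) = 0 := by
        intro p hp; have hpF : p ∉ Fo := fun h' => hp (Finset.mem_filter.1 h').2; simp only [hwodef, hpF, if_false]; rfl
      have hwo : ∀ p : Sym2 (Fin n), p ∉ Dp.erase s(o, u₁) → c ∉ p → (wo p : ℝ) = 0 := by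
        intro p hp hcp
        by_cases hpF : p ∈ wireSet So ∨ ∃ u ∈ So, p = s(u, c)
        · rw [hon p hpF]
          rcases hpF with hW | ⟨u, _, rfl⟩
          · by_cases hpD : p ∈ Dp
            · exfalso; refine hp (Finset.mem_erase.2 ⟨?_, hpD⟩); rintro rfl
              exact Set.disjoint_left.1 hdisjS (mk_mem_wireSet_iff.1 hW).2.1 hvS₁
            · exact hvp p hpD hcp
          · exact absurd (Sym2.mem_mk_right u c) hcp
        · exact hoff p hpF
      have hDc₁ : ∀ p ∈ Dp.erase s(o, u₁), c ∉ p := fun p hp => hDpc p (Finset.mem_of_mem_erase hp)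
      have hacyc₁ : (SimpleGraph.fromEdgeSet (↑(Dp.erase s(o, u₁)) : Set (Sym2 (Fin n)))).IsAcyclic := by
        rw [Finset.coe_erase]; exact hacycp.anti (SimpleGraph.fromEdgeSet_mono Set.sdiff_subset)
      obtain ⟨α', hα'F, hle⟩ := eventGluing_aux (Dp.erase s(o, u₁)).card (Dp.erase s(o, u₁)) wo c o (A.filter fun x => x ∈ So) rfl
        hDc₁ hacyc₁ hwo hoc hAo
      have hα'A : α' ∈ A := (Finset.mem_filter.1 hα'F).1
      have hα'S : α' ∈ So := (Finset.mem_filter.1 hα'F).2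
      have T1 : (prodBernoulli wo).real (openConn o c : Set (BondConfig (Fin n)))ᶜ = a :=
        real_local_not_openConn_hub v wo So c o hoSo hcSo hon hoff
      have T2 : (prodBernoulli wo).real ((openConn o c : Set (BondConfig (Fin n)))ᶜ ∩
          (⋃ a ∈ (A.filter fun x => x ∈ So), (openConn o a : Set (BondConfig (Fin n))))ᶜ) = b := by
        rw [real_local_not_openConn_hub_relays v wo So c o (A.filter fun x => x ∈ So) hoSo hcSo hon hoff, hubClosedRelayFree_filter_eq]
      have T3 : (prodBernoulli wo).real (openConn α' c : Set (BondConfig (Fin n)))ᶜ =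
          (prodBernoulli v).real {ω : BondConfig (Fin n) | ∀ u, ω ∈ openConnIn So α' u → s(u, c) ∉ ω} :=
        real_local_not_openConn_hub v wo So c α' hα'S hcSo hon hoff
      rw [T1, T2, T3] at hle
      have hdα : (prodBernoulli v).real {ω : BondConfig (Fin n) | ∀ u, ω ∈ openConnIn So α' u → s(u, c) ∉ ω} ≤ d := hdomS So o rfl hcSo α' hα'A hα'S
      have h1b : 0 ≤ 1 - b := by linarith
      exact hle.trans (mul_le_mul_of_nonneg_right hdα h1b)
    · have hset : {ω : BondConfig (Fin n) | ∀ u, ω ∈ openConnIn So o u → s(u, c) ∉ ω} =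
          {ω : BondConfig (Fin n) | ∀ u, ω ∈ openConnIn So o u → s(u, c) ∉ ω ∧ u ∉ A} := by
        ext ω; simp only [Set.mem_setOf_eq]
        refine forall_congr' fun u => ⟨fun h1 hu => ⟨h1 hu, fun huA => hAo ⟨u, ?_⟩⟩, fun h1 hu => (h1 hu).1⟩
        exact Finset.mem_filter.2 ⟨huA, (DCT16.pathIn_of_mem_openConnIn hu).right_mem⟩
      have hab : a = b := by rw [ha, hb, hset]
      rw [hab, sub_self]
      exact mul_nonneg (hd ▸ measureReal_nonneg) (by linarith)
  -- the designated two-block step, then back to events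
  have hstep := designated_step a b g h d ew hb0 hba ha1 hh0 hhg hg1 hew0 hewX hchild hroot
  have hN : (prodBernoulli v).real (openConn o c : Set (BondConfig (Fin n)))ᶜ = a * g := by rw [hM1]; ring
  have hB : (prodBernoulli v).real ((openConn o c : Set (BondConfig (Fin n)))ᶜ ∩ (⋃ a ∈ A, (openConn o a : Set (BondConfig (Fin n))))ᶜ) = b * h := by
    rw [hM2]; ring
  have hDv : (prodBernoulli v).real (openConn wr c : Set (BondConfig (Fin n)))ᶜ = d - (1 - a) * ew := by rw [hM3]; ring
  have hX : (prodBernoulli v).real ((⋃ a ∈ A, (openConn o a : Set (BondConfig (Fin n)))) ∩ (openConn o c : Set (BondConfig (Fin n)))ᶜ) = a * g - b * h := by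
    have h1 : (prodBernoulli v).real ((openConn o c : Set (BondConfig (Fin n)))ᶜ ∩ ⋃ a ∈ A, (openConn o a : Set (BondConfig (Fin n)))) +
        (prodBernoulli v).real ((openConn o c : Set (BondConfig (Fin n)))ᶜ \ ⋃ a ∈ A, (openConn o a : Set (BondConfig (Fin n)))) =
        (prodBernoulli v).real (openConn o c : Set (BondConfig (Fin n)))ᶜ :=
      measureReal_inter_add_sdiff MeasurableSet.of_discrete (measure_ne_top _ _)
    rw [Set.sdiff_eq, hB, hN] at h1
    rw [Set.inter_comm]; linarith
  have hY : (prodBernoulli v).real (⋃ a ∈ insert c A, (openConn o a : Set (BondConfig (Fin n)))) = 1 - b * h := by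
    rw [Finset.set_biUnion_insert]
    have hc : (prodBernoulli v).real ((openConn o c : Set (BondConfig (Fin n))) ∪ ⋃ a ∈ A, (openConn o a : Set (BondConfig (Fin n))))ᶜ =
        (prodBernoulli v).real Set.univ - (prodBernoulli v).real ((openConn o c : Set (BondConfig (Fin n))) ∪ ⋃ a ∈ A, (openConn o a : Set (BondConfig (Fin n)))) :=
      measureReal_compl MeasurableSet.of_discrete
    rw [probReal_univ, Set.compl_union, hB] at hc
    linarith
  rw [hX, hY, hDv]
  exact hstep

/-- **DESIGNATED Kozma–Nitzan Conjecture 1 on apex-forest graphs.**  If `G − c` is a forest (hub pairs arbitrary), `o ∉ A`, `c ∉ A`, and `wr ∈ A` is a WORST relay of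
`G − E(o)` — a maximiser of `μ_{w⁰}(a ↮ c)` where `w⁰` gives weight `0` to every pair containing `o` — then
`μ(o ↔ A, o ↮ c) ≤ μ(wr ↮ c) · μ(o ↔ A ∪ {c})`.  Proof: the corner principle `Corner.nonneg_of_corners` in the forest pairs at `o` (the designation does not
depend on them) reduces to `designated_corner`. [cite: KozmaNitzan2024, Conjecture 1 (p. 3), Questions 8–9] -/
theorem designated (w : Sym2 (Fin n) → unitInterval) (c : Fin n) (D : Finset (Sym2 (Fin n)))
    (hDc : ∀ p ∈ D, c ∉ p) (hacyc : (SimpleGraph.fromEdgeSet (↑D : Set (Sym2 (Fin n)))).IsAcyclic)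
    (hw : ∀ p : Sym2 (Fin n), p ∉ D → c ∉ p → (w p : ℝ) = 0) (A : Finset (Fin n)) (o : Fin n) (hoc : o ≠ c) (hoA : o ∉ A) (hcA : c ∉ A)
    (wr : Fin n) (hwr : wr ∈ A)
    (hmax : ∀ a ∈ A, (prodBernoulli (fun p => if o ∈ p then 0 else w p)).real (openConn a c : Set (BondConfig (Fin n)))ᶜ ≤
      (prodBernoulli (fun p => if o ∈ p then 0 else w p)).real (openConn wr c : Set (BondConfig (Fin n)))ᶜ) :
    (prodBernoulli w).real ((⋃ a ∈ A, (openConn o a : Set (BondConfig (Fin n)))) ∩ (openConn o c : Set (BondConfig (Fin n)))ᶜ) ≤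
      (prodBernoulli w).real (openConn wr c : Set (BondConfig (Fin n)))ᶜ *
        (prodBernoulli w).real (⋃ a ∈ insert c A, (openConn o a : Set (BondConfig (Fin n)))) := by
  have key := Corner.nonneg_of_corners (X := (⋃ a ∈ A, (openConn o a : Set (BondConfig (Fin n)))) ∩ (openConn o c : Set (BondConfig (Fin n)))ᶜ)
    (isUpperSet_openConn wr c).compl (isUpperSet_biUnion_openConn o (insert c A)) (D.filter fun p => o ∈ p) w ?_
  · linarith
  intro v hvS hv01
  -- `v` is again an apex-forest weight with `{0,1}` values on the forest pairs at `o`, and `v⁰ = w⁰`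
  have hv : ∀ p : Sym2 (Fin n), p ∉ D → c ∉ p → (v p : ℝ) = 0 := by
    intro p hp hcp
    rw [hvS p (fun h => hp (Finset.mem_filter.1 h).1)]; exact hw p hp hcp
  have h01 : ∀ p ∈ D, o ∈ p → v p = 0 ∨ v p = 1 := fun p hp hop => hv01 p (Finset.mem_filter.2 ⟨hp, hop⟩)
  have hv0 : (fun p : Sym2 (Fin n) => if o ∈ p then (0 : unitInterval) else v p) = fun p => if o ∈ p then 0 else w p := by
    funext p
    by_cases hop : o ∈ p
    · simp only [hop, if_true]
    · simp only [hop, if_false]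
      exact hvS p (fun h => hop (Finset.mem_filter.1 h).2)
  have hmaxv : ∀ a ∈ A, (prodBernoulli (fun p => if o ∈ p then 0 else v p)).real (openConn a c : Set (BondConfig (Fin n)))ᶜ ≤
      (prodBernoulli (fun p => if o ∈ p then 0 else v p)).real (openConn wr c : Set (BondConfig (Fin n)))ᶜ := by
    rw [hv0]; exact hmax
  have := designated_corner v c D hDc hacyc hv A o hoc hoA hcA h01 wr hwr hmaxv
  linarith

end ApexForest

end Summit.CriticalPhenomena.PercolationContinuityZ3.Theorems
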